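import Summits.RiemannHypothesis.RiemannHypothesis.Theorems.TiltedLandingLaw421R3BurgersRate

/-! # RATE residual `RhW08.RateSplit.RateLawsHalfQ` — typed socket frame of the LENS-2 line (defs + proved glue only), v2
Landable companion of the lens-2 gen-3 skeleton `rh33346-cover/lens2/RateSkeleton-v2.lean` (every `def` and every fully proved theorem, NO stubs;
director (CA482)(2)(a)/(CA486)).  v2 = v1 (8de50b81a1565867) + ONE typing repair (director (CA485)): every child binder is the AXIS-centred closed Jensen
disc `‖w − ↑(v.re)‖ ≤ |v.im|` — the `hsign` of the proved sharp step `RhW08.FarStep.sharp_step_energy_eta_weak` — replacing the tree's v-centred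
`‖w − v‖ ≤ |v.im|` (…R3BurgersRate:76/87/114; a laterally escaping successor violates it, hazard T-NEST); the modulus law and GLUE-2 are re-posed on it
(`FarFieldModulusLawA`, `F1OfModulusLawA`), and §J CERTIFIES the binder (kernel): by Jensen's theorem for iterated derivatives
(`Literature.Analysis.Complex.jensen_circle_iteratedDeriv_pos`, Ki–Kim 2000 §2) every upper zero of `f⁽ᵏ⁺¹⁾` within `R/2 − Hs` of a far state lies in its
closed Jensen disc (`nested_of_jensen_far`, `nested_child_of_far_level`), and at a critical point the binder is EQUIVALENT to the cofactor field pointing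
down (`im_field_mul_normSq_pairQ`, `nested_iff_field_im_nonpos`).
Target socket (tree `…R3RateSplit`): `RateLawsHalfQ = ∃ aR aC, F1 ∧ F2 aR ∧ C aC ∧ A (approachBudgetHalfQ aR aC)`, F1 `FarEnergyLawCQ (4/5)`,
F2 `EnergyRiseLawQ aR`, C `ConsLawQ aC`, A `ApproachAllowanceQ …`.  §0 `FarNode`/`FarEntry` (binder block at one level; level-wise chain entry) · §J the
nestedness certificate · §1 `LandingExitLaw(Above) c m` + `no_charge_after_landing(_above)` (kernel: `ReadyR2` state-free and cumulative) · §2 the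
one-level laws `ThresholdCapLawCharged/Below θ`, `UnchargedCreepLaw θu`, the entry/exit law `FarChainEntryExitLaw θ'` + corollary
`FarChainEntryLawCharged` · §3 glue `ModulusOfLawsG3A` (laws ⇒ `FarFieldModulusLawA λ`, `λ = (1+θ)(1+θ')e^{2θu}`), `lam_sq_le_record` (kernel,
θ = 1/200, θ' = 1/25, θu = 3/100), `farEnergyLawCQ_of_laws` (laws ⇒ `FarEnergyLawCQ (4/5)` by name) · §4 `rateLawsHalfQ_of` (four sockets by tree names ⇒
`RateLawsHalfQ`), `rateLawsHalfQ_iff`, CANONICAL budgets `riseSupQ`/`consSupQ` with `nonFarSocketsHalfQ_iff_canonical`, `rateLawsHalfQ_iff_canonical`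
(F2/C upward-, A downward-closed in the budget: nothing lost by fixing them; the non-far analytic content is the ONE inequality Ac).
All laws are TYPED, not proved; columns / kill numbers in `rh33346-cover/LENS-2-NODE-v6.md`/v6b.  Nothing here bears on the truth of RH; RH is not
proved; 33346/33347 OPEN. -/

namespace RhW08.BurgersRateG3
open Complex
open scoped ComplexConjugate
open RhW08.Round1 RhW08.StSwap RhW08.Round2 RhW08.QuadW
open RhW08.SealSwap (PBot)
open RhW08.SealSwapQ RhW08.RateSplit RhW08.IsolatedTilt RhW08.FarStep RhW08.BurgersRate RhW08.PurseP
open RhIdea6.G17.W07C7 RhIdea6.G17.W07C7.Rev6 RhIdea6.G18.W07C8.Law421BirthS RhIdea6.G19.W07C11.Seam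
open RhIdea6.G20.W07C12.Frac RhIdea6.G20.W07C12.StColP RhW07.C12.FieldSplit RhIdea6.G21.W07C13.TentMax
open RhW07.C14.TwoSided RhW07.C14.Classes RhW07.C14.Lineage RhW07.C14.Booking

/-! ## §0 the FAR NODE packaging -/
/-- FAR NODE of level `k`: far level, lowest tracked state `v` (simple, alone with `v̄` in its `R/2` window), upper zero `w` of `f⁽ᵏ⁺¹⁾` nested in `v`'s
JENSEN disc `‖w − Re v‖ ≤ Im v` (v2 (CA485): AXIS-centred = the `hsign` of `RhW08.FarStep.sharp_step_energy_eta_weak`; CERTIFIED at far levels by §J).  `κ_k := ‖farFieldAt f k v w‖` is the one number per node (at a node `f⁽ᵏ⁺¹⁾ w = 0`, so it is the pair's own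
field at its child). -/
def FarNode (η : ℝ) (f : ℂ → ℂ) (x₀ s hmax R Hs : ℝ) (B : ℕ) (k : ℕ) (v w : ℂ) : Prop :=
  FarLevelQ η f x₀ s hmax R Hs B k ∧ IsLowest StTrkDQ η f x₀ s hmax R Hs B k v ∧ iteratedDeriv (k + 1) f v ≠ 0 ∧
    (∀ z : ℂ, iteratedDeriv k f z = 0 → |z.re - v.re| < R / 2 → z = v ∨ z = conj v) ∧
    iteratedDeriv (k + 1) f w = 0 ∧ 0 < w.im ∧ ‖w - (v.re : ℂ)‖ ≤ |v.im|
/-- LEVEL-WISE CHAIN ENTRY: level `k` is an entry level iff `k = 0` or level `k − 1` carries NO far node.  Lineage-free by design: the walk-back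
induction of the glue stops exactly here. -/
def FarEntry (η : ℝ) (f : ℂ → ℂ) (x₀ s hmax R Hs : ℝ) (B : ℕ) (k : ℕ) : Prop :=
  k = 0 ∨ ∀ v₀ w₀ : ℂ, ¬ FarNode η f x₀ s hmax R Hs B (k - 1) v₀ w₀
/-! ## §J the JENSEN NESTEDNESS CERTIFICATE (why the axis-centred binder is not a hole) -/
/-- (K) §J.1 **far isolation + Jensen ⇒ nested.** If some upper zero `a` of `g` has `w` in its closed Jensen disc (the conclusion shape of
`Literature.Analysis.Complex.jensen_circle_iteratedDeriv_pos`), every zero of `g` in the lateral `R/2`-window of `v` is `v` or `v̄`, all zeros of `g` lie in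
the strip `|Im| ≤ Hs`, and `w` is within `R/2 − Hs` of `v` laterally, then `w` lies in `v`'s closed Jensen disc `‖w − Re v‖ ≤ |Im v|`. Pure logic. -/
theorem nested_of_jensen_far {g : ℂ → ℂ} {v w : ℂ} {R Hs : ℝ}
    (hJ : ∃ a : ℂ, g a = 0 ∧ 0 < a.im ∧ (w.re - a.re) ^ 2 + w.im ^ 2 ≤ a.im ^ 2)
    (hfar : ∀ z : ℂ, g z = 0 → |z.re - v.re| < R / 2 → z = v ∨ z = conj v) (hstrip : ∀ z : ℂ, g z = 0 → |z.im| ≤ Hs)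
    (hnear : |w.re - v.re| < R / 2 - Hs) : ‖w - (v.re : ℂ)‖ ≤ |v.im| := by
  obtain ⟨a, ha, ha0, hdisc⟩ := hJ
  have hwa : |w.re - a.re| ≤ a.im := by
    rw [← Real.sqrt_sq ha0.le, ← Real.sqrt_sq_eq_abs]
    exact Real.sqrt_le_sqrt (by nlinarith [sq_nonneg w.im])
  have haHs : a.im ≤ Hs := by have := hstrip a ha; rwa [abs_of_pos ha0] at this
  by_cases hwin : |a.re - v.re| < R / 2
  · -- `a` is `v` or `v̄`: same real part, same |Im|
    have hre : a.re = v.re ∧ a.im ^ 2 = v.im ^ 2 := by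
      rcases hfar a ha hwin with h | h
      · subst h; exact ⟨rfl, rfl⟩
      · subst h; simp [Complex.conj_re, Complex.conj_im]
    have hn : ‖w - (v.re : ℂ)‖ ^ 2 = (w.re - v.re) ^ 2 + w.im ^ 2 := by
      rw [← Complex.normSq_eq_norm_sq, Complex.normSq_apply, Complex.sub_re, Complex.sub_im, Complex.ofReal_re, Complex.ofReal_im, sub_zero]
      ring
    have h2 : ‖w - (v.re : ℂ)‖ ^ 2 ≤ |v.im| ^ 2 := by rw [hn, sq_abs, ← hre.2, ← hre.1]; exact hdisc
    calc ‖w - (v.re : ℂ)‖ = Real.sqrt (‖w - (v.re : ℂ)‖ ^ 2) := (Real.sqrt_sq (norm_nonneg _)).symm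
      _ ≤ Real.sqrt (|v.im| ^ 2) := Real.sqrt_le_sqrt h2
      _ = |v.im| := Real.sqrt_sq (abs_nonneg _)
  · -- `a` is a far zero: then `w` is laterally far from `v`, contradiction
    exfalso
    rw [not_lt] at hwin
    have : R / 2 - Hs ≤ |w.re - v.re| := by
      have htri : |a.re - v.re| ≤ |w.re - a.re| + |w.re - v.re| := by
        have := abs_sub_le (a.re : ℝ) w.re v.re
        rwa [abs_sub_comm a.re w.re] at this
      linarith
    linarith
/-- (K) §J.2 **the certificate at a far level of the frame**, hypotheses in the shape of the Literature theorem: `f` real entire of order `< 2` with no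
derivative vanishing identically; then every upper zero `w` of `f⁽ᵏ⁺¹⁾` within `R/2 − Hs` of a far state `v` of level `k` (strip `|Im| ≤ Hs` at level `k`,
e.g. from `Literature.Analysis.Complex.abs_im_le_of_iteratedDeriv_eq_zero`) is nested in `v`'s closed Jensen disc — the binder of every law below. -/
theorem nested_child_of_far_level {f : ℂ → ℂ} (hf : Differentiable ℂ f) {ρ C : ℝ} (hρ0 : 0 ≤ ρ) (hρ : ρ < 2)
    (hgr : ∀ z, ‖f z‖ ≤ C * Real.exp (‖z‖ ^ ρ)) (hreal : ∀ x : ℝ, (f x).im = 0) (hnz : ∀ n : ℕ, iteratedDeriv n f ≠ 0)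
    (k : ℕ) {v w : ℂ} {R Hs : ℝ} (hw : 0 < w.im) (hfw : iteratedDeriv (k + 1) f w = 0)
    (hfar : ∀ z : ℂ, iteratedDeriv k f z = 0 → |z.re - v.re| < R / 2 → z = v ∨ z = conj v)
    (hstrip : ∀ z : ℂ, iteratedDeriv k f z = 0 → |z.im| ≤ Hs) (hnear : |w.re - v.re| < R / 2 - Hs) : ‖w - (v.re : ℂ)‖ ≤ |v.im| :=
  nested_of_jensen_far (Literature.Analysis.Complex.jensen_circle_iteratedDeriv_pos hf hρ0 hρ hgr hreal hnz k hw hfw) hfar hstrip hnear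
/-- (K) §J.3 **the field identity at a critical point.** If `q(w)·K = −2(w − a)` (the critical-point relation of `G = q·h`, `K = h′(w)/h(w)`, as in
`RhW08.FarStep.position_of_field`) with `q = pairQ a b`, then `Im K · ‖q(w)‖² = −2·Im w·(b² − ‖w − a‖²)`. -/
theorem im_field_mul_normSq_pairQ {w K : ℂ} {a b : ℝ} (h : pairQ a b w * K = -(2 * (w - a))) :
    K.im * ‖pairQ a b w‖ ^ 2 = -(2 * w.im * (b ^ 2 - ‖w - (a : ℂ)‖ ^ 2)) := by
  have hn : ‖w - (a : ℂ)‖ ^ 2 = (w.re - a) ^ 2 + w.im ^ 2 := by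
    rw [← Complex.normSq_eq_norm_sq, Complex.normSq_apply, Complex.sub_re, Complex.sub_im, Complex.ofReal_re, Complex.ofReal_im, sub_zero]; ring
  have hq : ‖pairQ a b w‖ ^ 2 = (pairQ a b w).re ^ 2 + (pairQ a b w).im ^ 2 := by
    rw [← Complex.normSq_eq_norm_sq, Complex.normSq_apply]; ring
  have hqre : (pairQ a b w).re = (w.re - a) ^ 2 - w.im ^ 2 + b ^ 2 := by
    simp [pairQ, sq, Complex.mul_re, Complex.sub_re, Complex.sub_im, Complex.ofReal_re, Complex.ofReal_im]
  have hqim : (pairQ a b w).im = 2 * (w.re - a) * w.im := by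
    simp [pairQ, sq, Complex.mul_im, Complex.sub_re, Complex.sub_im, Complex.ofReal_re, Complex.ofReal_im]
    ring
  have hre := congrArg Complex.re h
  have him := congrArg Complex.im h
  simp only [Complex.mul_re, Complex.mul_im, Complex.neg_re, Complex.neg_im, Complex.sub_re, Complex.sub_im,
    Complex.ofReal_re, Complex.ofReal_im, Complex.re_ofNat, Complex.im_ofNat, hqre, hqim, zero_mul, sub_zero, add_zero] at hre him
  rw [hq, hn, hqre, hqim]
  linear_combination ((w.re - a) ^ 2 - w.im ^ 2 + b ^ 2) * him - (2 * (w.re - a) * w.im) * hre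
/-- (K) §J.4 **nested ⟺ field points down.** At an upper-half-plane critical point with `q(w) ≠ 0` and `0 ≤ b`: `‖w − a‖ ≤ b ↔ Im K ≤ 0` — the
axis-centred binder is exactly the sign condition that the tree's off-Jensen sign step / `RhW08.BurgersRate.FarPairsPushDown` deliver at far levels. -/
theorem nested_iff_field_im_nonpos {w K : ℂ} {a b : ℝ} (h : pairQ a b w * K = -(2 * (w - a))) (hw : 0 < w.im) (hb : 0 ≤ b)
    (hq : pairQ a b w ≠ 0) : ‖w - (a : ℂ)‖ ≤ b ↔ K.im ≤ 0 := by
  have hid := im_field_mul_normSq_pairQ h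
  have hqpos : 0 < ‖pairQ a b w‖ ^ 2 := by positivity
  constructor
  · intro hle
    have h2 : ‖w - (a : ℂ)‖ ^ 2 ≤ b ^ 2 := pow_le_pow_left₀ (norm_nonneg _) hle 2
    nlinarith [hid, h2, hw]
  · intro hK
    have h2 : ‖w - (a : ℂ)‖ ^ 2 ≤ b ^ 2 := by
      by_contra hlt; rw [not_le] at hlt
      have : 0 < K.im * ‖pairQ a b w‖ ^ 2 := by rw [hid]; nlinarith [hw, hlt]
      nlinarith [this, hqpos.le, hK, mul_nonpos_of_nonpos_of_nonneg hK hqpos.le]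
    calc ‖w - (a : ℂ)‖ = Real.sqrt (‖w - (a : ℂ)‖ ^ 2) := (Real.sqrt_sq (norm_nonneg _)).symm
      _ ≤ Real.sqrt (b ^ 2) := Real.sqrt_le_sqrt h2
      _ = b := Real.sqrt_sq hb
/-! ## §1 the LANDING-EXIT LAW -/
/-- (T-LZ) **landing-exit law** `LandingExitLaw c m`: at a far node `(k, v, w)` in the landing zone `κ_k·Im w < c` EVERY state is `ReadyR2` by level
`k + m` (state-free conclusion).  Of record: `c = 5/4`, `m = 2`. -/
def LandingExitLaw (c : ℝ) (m : ℕ) : Prop :=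
  ∀ (η : ℝ) (f : ℂ → ℂ) (x₀ s hmax R Hs : ℝ) (B : ℕ), EngineHyps5 2 η f x₀ s hmax R Hs B →
    ∀ (k : ℕ) (v w : ℂ), FarNode η f x₀ s hmax R Hs B k v w → ‖farFieldAt f k v w‖ * w.im < c →
      ∀ u : ℂ, ReadyR2 η f x₀ s hmax R Hs B (k + m) u
/-- (T-LZ above threshold — the population the glue consumes: `η/s < κ_k`.) -/
def LandingExitLawAbove (c : ℝ) (m : ℕ) : Prop :=
  ∀ (η : ℝ) (f : ℂ → ℂ) (x₀ s hmax R Hs : ℝ) (B : ℕ), EngineHyps5 2 η f x₀ s hmax R Hs B →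
    ∀ (k : ℕ) (v w : ℂ), FarNode η f x₀ s hmax R Hs B k v w → η / s < ‖farFieldAt f k v w‖ → ‖farFieldAt f k v w‖ * w.im < c →
      ∀ u : ℂ, ReadyR2 η f x₀ s hmax R Hs B (k + m) u
/-- (K) the unrestricted law implies the above-threshold form. -/
theorem landingExitLawAbove_of (c : ℝ) (m : ℕ) (h : LandingExitLaw c m) : LandingExitLawAbove c m :=
  fun η f x₀ s hmax R Hs B hE k v w hN _ hc => h η f x₀ s hmax R Hs B hE k v w hN hc
/-- (K) `ReadyR2 = CumReady WinOrTilt` is cumulative in the level. -/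
theorem readyR2_mono {η : ℝ} {f : ℂ → ℂ} {x₀ s hmax R Hs : ℝ} {B : ℕ} {j j' : ℕ} {u : ℂ} (hjj : j ≤ j')
    (h : ReadyR2 η f x₀ s hmax R Hs B j u) : ReadyR2 η f x₀ s hmax R Hs B j' u := by
  simp only [ReadyR2, CumReady] at h ⊢
  obtain ⟨j₀, hj₀, hR⟩ := h
  exact ⟨j₀, hj₀.trans hjj, hR⟩
/-- (K) a level at which every state is `ReadyR2` is not charged (charge needs a non-ready lowest state). -/
theorem not_charged_of_readyR2_all {η : ℝ} {f : ℂ → ℂ} {x₀ s hmax R Hs : ℝ} {B : ℕ} {i : ℕ}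
    (h : ∀ u : ℂ, ReadyR2 η f x₀ s hmax R Hs B i u) : ¬ Charged (PTrkSQ PBot) StTrkDQ ReadyR2 η f x₀ s hmax R Hs B i := by
  intro hc
  unfold Charged at hc
  obtain ⟨v, _, hnr, _⟩ := hc
  exact hnr (h v)
/-- ★ (K) **NO CHARGE AFTER LANDING**: under `LandingExitLaw c m`, past a landing-zone far node of level `k` no level `≥ k + m` of the frame is charged. -/
theorem no_charge_after_landing {c : ℝ} {m : ℕ} (hL : LandingExitLaw c m) {η : ℝ} {f : ℂ → ℂ} {x₀ s hmax R Hs : ℝ} {B : ℕ}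
    (hE : EngineHyps5 2 η f x₀ s hmax R Hs B) {k : ℕ} {v w : ℂ} (hN : FarNode η f x₀ s hmax R Hs B k v w)
    (hc : ‖farFieldAt f k v w‖ * w.im < c) : ∀ i : ℕ, k + m ≤ i → ¬ Charged (PTrkSQ PBot) StTrkDQ ReadyR2 η f x₀ s hmax R Hs B i :=
  fun _ hi => not_charged_of_readyR2_all fun u => readyR2_mono hi (hL η f x₀ s hmax R Hs B hE k v w hN hc u)
/-- (K) same, above-threshold form. -/
theorem no_charge_after_landing_above {c : ℝ} {m : ℕ} (hL : LandingExitLawAbove c m) {η : ℝ} {f : ℂ → ℂ} {x₀ s hmax R Hs : ℝ} {B : ℕ}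
    (hE : EngineHyps5 2 η f x₀ s hmax R Hs B) {k : ℕ} {v w : ℂ} (hN : FarNode η f x₀ s hmax R Hs B k v w)
    (hthr : η / s < ‖farFieldAt f k v w‖) (hc : ‖farFieldAt f k v w‖ * w.im < c) :
    ∀ i : ℕ, k + m ≤ i → ¬ Charged (PTrkSQ PBot) StTrkDQ ReadyR2 η f x₀ s hmax R Hs B i :=
  fun _ hi => not_charged_of_readyR2_all fun u => readyR2_mono hi (hL η f x₀ s hmax R Hs B hE k v w hN hthr hc u)
/-! ## §2 the ONE-LEVEL LAWS between consecutive far levels and the LEVEL-WISE ENTRY/EXIT LAW -/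
/-- (T-CAP⁰; gen-2 text `ThresholdCapG2c.lean` 08c6e556) charged-successor threshold cap: consecutive far levels `j, j+1`, level `j+1` CHARGED ⇒ `κ_{j+1} ≤ max κ_j ((1+θ)η/s)`. -/
def ThresholdCapLawCharged (θ : ℝ) : Prop :=
  ∀ (η : ℝ) (f : ℂ → ℂ) (x₀ s hmax R Hs : ℝ) (B : ℕ), EngineHyps5 2 η f x₀ s hmax R Hs B →
    ∀ (j : ℕ) (v w v' w' : ℂ), FarLevelQ η f x₀ s hmax R Hs B j → FarLevelQ η f x₀ s hmax R Hs B (j + 1) →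
      Charged (PTrkSQ PBot) StTrkDQ ReadyR2 η f x₀ s hmax R Hs B (j + 1) →
      IsLowest StTrkDQ η f x₀ s hmax R Hs B j v → iteratedDeriv (j + 1) f v ≠ 0 →
        (∀ z : ℂ, iteratedDeriv j f z = 0 → |z.re - v.re| < R / 2 → z = v ∨ z = conj v) → iteratedDeriv (j + 1) f w = 0 → 0 < w.im → ‖w - (v.re : ℂ)‖ ≤ |v.im| →
      IsLowest StTrkDQ η f x₀ s hmax R Hs B (j + 1) v' → iteratedDeriv (j + 2) f v' ≠ 0 →
        (∀ z : ℂ, iteratedDeriv (j + 1) f z = 0 → |z.re - v'.re| < R / 2 → z = v' ∨ z = conj v') → iteratedDeriv (j + 2) f w' = 0 → 0 < w'.im →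
        ‖w' - (v'.re : ℂ)‖ ≤ |v'.im| →
      ‖farFieldAt f (j + 1) v' w'‖ ≤ max ‖farFieldAt f j v w‖ ((1 + θ) * η / s)
/-- (T-CAP-below; gen-2 text `ThresholdCapG2c.lean` 08c6e556) below-threshold cap through ANY successor: `κ_j ≤ (1+θ)η/s ⇒ κ_{j+1} ≤ (1+θ)η/s`. -/
def ThresholdCapLawBelow (θ : ℝ) : Prop :=
  ∀ (η : ℝ) (f : ℂ → ℂ) (x₀ s hmax R Hs : ℝ) (B : ℕ), EngineHyps5 2 η f x₀ s hmax R Hs B →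
    ∀ (j : ℕ) (v w v' w' : ℂ), FarLevelQ η f x₀ s hmax R Hs B j → FarLevelQ η f x₀ s hmax R Hs B (j + 1) →
      IsLowest StTrkDQ η f x₀ s hmax R Hs B j v → iteratedDeriv (j + 1) f v ≠ 0 →
        (∀ z : ℂ, iteratedDeriv j f z = 0 → |z.re - v.re| < R / 2 → z = v ∨ z = conj v) → iteratedDeriv (j + 1) f w = 0 → 0 < w.im → ‖w - (v.re : ℂ)‖ ≤ |v.im| →
      IsLowest StTrkDQ η f x₀ s hmax R Hs B (j + 1) v' → iteratedDeriv (j + 2) f v' ≠ 0 →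
        (∀ z : ℂ, iteratedDeriv (j + 1) f z = 0 → |z.re - v'.re| < R / 2 → z = v' ∨ z = conj v') → iteratedDeriv (j + 2) f w' = 0 → 0 < w'.im →
        ‖w' - (v'.re : ℂ)‖ ≤ |v'.im| →
      ‖farFieldAt f j v w‖ ≤ (1 + θ) * η / s →
      ‖farFieldAt f (j + 1) v' w'‖ ≤ (1 + θ) * η / s
/-- (T-CREEP; gen-2 text `ThresholdCapG2c.lean` 08c6e556) uncharged creep above threshold, away from the landing zone (`κ_j·Im w_j ≥ 5/4`): `κ_{j+1} ≤ κ_j·(1 + θu·s²/(Im w_j)²)`. -/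
def UnchargedCreepLaw (θu : ℝ) : Prop :=
  ∀ (η : ℝ) (f : ℂ → ℂ) (x₀ s hmax R Hs : ℝ) (B : ℕ), EngineHyps5 2 η f x₀ s hmax R Hs B →
    ∀ (j : ℕ) (v w v' w' : ℂ), FarLevelQ η f x₀ s hmax R Hs B j → FarLevelQ η f x₀ s hmax R Hs B (j + 1) →
      ¬ Charged (PTrkSQ PBot) StTrkDQ ReadyR2 η f x₀ s hmax R Hs B (j + 1) →
      IsLowest StTrkDQ η f x₀ s hmax R Hs B j v → iteratedDeriv (j + 1) f v ≠ 0 →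
        (∀ z : ℂ, iteratedDeriv j f z = 0 → |z.re - v.re| < R / 2 → z = v ∨ z = conj v) → iteratedDeriv (j + 1) f w = 0 → 0 < w.im → ‖w - (v.re : ℂ)‖ ≤ |v.im| →
      IsLowest StTrkDQ η f x₀ s hmax R Hs B (j + 1) v' → iteratedDeriv (j + 2) f v' ≠ 0 →
        (∀ z : ℂ, iteratedDeriv (j + 1) f z = 0 → |z.re - v'.re| < R / 2 → z = v' ∨ z = conj v') → iteratedDeriv (j + 2) f w' = 0 → 0 < w'.im →
        ‖w' - (v'.re : ℂ)‖ ≤ |v'.im| →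
      η / s < ‖farFieldAt f j v w‖ → (5 : ℝ) / 4 ≤ ‖farFieldAt f j v w‖ * w.im →
      ‖farFieldAt f (j + 1) v' w'‖ ≤ ‖farFieldAt f j v w‖ * (1 + θu * s ^ 2 / w.im ^ 2)
/-- (T-ENTRY) **far-chain entry/exit law** `FarChainEntryExitLaw θ'`: at a level-wise ENTRY far node `(k, v, w)` (`FarEntry k`) that is HOT
(`κ_k > (1+θ')η/s`) no level `j ≥ k` is charged while the levels `k … j` stay far; its `j = k` instance is the tree's B5 on charged entries
(`farChainEntryLawCharged_of_exit`).  Data (v6b): absolute `κ_child ≤ 1.03·η/s < 1.04·η/s` on all 11 600 sampled nodes — the hot population is ≈ empty. -/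
def FarChainEntryExitLaw (θ' : ℝ) : Prop :=
  ∀ (η : ℝ) (f : ℂ → ℂ) (x₀ s hmax R Hs : ℝ) (B : ℕ), EngineHyps5 2 η f x₀ s hmax R Hs B →
    ∀ (k : ℕ) (v w : ℂ), FarNode η f x₀ s hmax R Hs B k v w → FarEntry η f x₀ s hmax R Hs B k →
      (1 + θ') * η / s < ‖farFieldAt f k v w‖ →
      ∀ j : ℕ, k ≤ j → (∀ i : ℕ, k ≤ i → i ≤ j → FarLevelQ η f x₀ s hmax R Hs B i) →
        ¬ Charged (PTrkSQ PBot) StTrkDQ ReadyR2 η f x₀ s hmax R Hs B j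
/-- (B5 restricted to level-wise CHARGED entries — the form the walk-back GLUE consumes at the chain start.) -/
def FarChainEntryLawCharged (θ' : ℝ) : Prop :=
  ∀ (η : ℝ) (f : ℂ → ℂ) (x₀ s hmax R Hs : ℝ) (B : ℕ), EngineHyps5 2 η f x₀ s hmax R Hs B →
    ∀ (k : ℕ) (v w : ℂ), FarNode η f x₀ s hmax R Hs B k v w → FarEntry η f x₀ s hmax R Hs B k →
      Charged (PTrkSQ PBot) StTrkDQ ReadyR2 η f x₀ s hmax R Hs B k → ‖farFieldAt f k v w‖ ≤ (1 + θ') * η / s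
/-- (K) the charged-entry bound is the `j = k` instance of the entry/exit law. -/
theorem farChainEntryLawCharged_of_exit (θ' : ℝ) (h : FarChainEntryExitLaw θ') : FarChainEntryLawCharged θ' := by
  intro η f x₀ s hmax R Hs B hE k v w hN hent hch
  by_contra hlt
  push Not at hlt
  have hfar : ∀ i : ℕ, k ≤ i → i ≤ k → FarLevelQ η f x₀ s hmax R Hs B i := by
    intro i hki hik
    obtain rfl : i = k := le_antisymm hik hki
    exact hN.1
  exact h η f x₀ s hmax R Hs B hE k v w hN hent hlt k le_rfl hfar hch
/-! ## §3 the WALK-BACK GLUE, the numeric side condition, and the F1 assembly -/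
/-- (v2, director (CA485)) the far-field MODULUS LAW on the AXIS-centred Jensen disc: token-identical to the tree's
`RhW08.BurgersRate.FarFieldModulusLaw lam` (…R3BurgersRate:76) except for the child binder `‖w − ↑(v.re)‖ ≤ |v.im|` in place of `‖w − v‖ ≤ |v.im|`.
This is the typing `sharp_step_energy_eta_weak` consumes (`hsign`), and by §J every upper zero of `f⁽ʲ⁺¹⁾` in the near window of a far state satisfies it. -/
def FarFieldModulusLawA (lam : ℝ) : Prop :=
  ∀ (η : ℝ) (f : ℂ → ℂ) (x₀ s hmax R Hs : ℝ) (B : ℕ), EngineHyps5 2 η f x₀ s hmax R Hs B →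
    ∀ (j : ℕ) (v w : ℂ), FarLevelQ η f x₀ s hmax R Hs B j → Charged (PTrkSQ PBot) StTrkDQ ReadyR2 η f x₀ s hmax R Hs B j →
      IsLowest StTrkDQ η f x₀ s hmax R Hs B j v → iteratedDeriv (j + 1) f v ≠ 0 →
        (∀ z : ℂ, iteratedDeriv j f z = 0 → |z.re - v.re| < R / 2 → z = v ∨ z = conj v) → iteratedDeriv (j + 1) f w = 0 → 0 < w.im →
        ‖w - (v.re : ℂ)‖ ≤ |v.im| →
      ‖farFieldAt f j v w‖ ≤ lam * η / s
/-- (GLUE-2A, v2) the tree's GLUE-2 `RhW08.BurgersRate.F1OfModulusLaw` re-posed on the axis-centred modulus law: modulus law (`λ² ≤ 5/4`) ⇒ F1(4/5).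
Attack: `sharp_step_energy_eta_weak` at the tracked successor `w` of the lowest state `v = a + ib` of a charged far level (`hsign` = the binder, now
certified by §J; `hhigh` from the quarter-drop / aloft clauses; `hKM` = the modulus law) + the books' identification of `lowH` at `j, j+1`. -/
def F1OfModulusLawA : Prop :=
  ∀ lam : ℝ, 0 < lam → lam ^ 2 ≤ 5 / 4 → FarFieldModulusLawA lam → FarEnergyLawCQ (4 / 5)
/-- (GLUE-G3A — strong induction on the level, walking back from a charged far node through consecutive far levels; each step is owned by one law:
successor CHARGED ⇒ cap-charged; uncharged & `κ ≤ (1+θ)η/s` ⇒ cap-below; uncharged & hot & `κ·Im w ≥ 5/4` ⇒ creep (total factor `≤ e^{θu·Λ}`, `Λ = 2`,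
creep heights `s/4`-separated and `≥ 2.23s`); uncharged & hot & `κ·Im w < 5/4` ⇒ landing exit ⇒ no charged level two steps later
(`no_charge_after_landing_above`); the walk starts at a level-wise ENTRY, settled by `FarChainEntryExitLaw`.  Books' input: on a linked far chain the
nested child is the tracked successor (lineage lemmas of `RhW07.C14.Lineage`).  v2: conclusion on the AXIS-centred disc.) -/
def ModulusOfLawsG3A : Prop :=
  ∀ θ θu θ' : ℝ, 0 ≤ θ → 0 ≤ θu → 0 ≤ θ' → ((1 + θ) * (1 + θ') * Real.exp (2 * θu)) ^ 2 ≤ 5 / 4 →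
    LandingExitLawAbove (5 / 4) 2 → ThresholdCapLawCharged θ → ThresholdCapLawBelow θ → UnchargedCreepLaw θu → FarChainEntryExitLaw θ' →
    FarFieldModulusLawA ((1 + θ) * (1 + θ') * Real.exp (2 * θu))
/-- (K) the numeric side condition at the constants of record θ = 1/200, θ' = 1/25, θu = 3/100, Λ = 2:
`((1 + 1/200)(1 + 1/25)·e^{0.06})² = 1.0924…·e^{0.12} ≤ 1.0924…·(25/22) = 1.2414… ≤ 5/4` (`Real.exp_bound_div_one_sub_of_interval`). -/
theorem lam_sq_le_record : ((1 + 1 / 200) * (1 + 1 / 25) * Real.exp (2 * (3 / 100)) : ℝ) ^ 2 ≤ 5 / 4 := by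
  have h1 : Real.exp (2 * (3 / 100) : ℝ) ^ 2 = Real.exp (3 / 25) := by
    rw [sq, ← Real.exp_add]; norm_num
  have h2 : Real.exp (3 / 25 : ℝ) ≤ 1 / (1 - 3 / 25) := Real.exp_bound_div_one_sub_of_interval (by norm_num) (by norm_num)
  have h3 : ((1 + 1 / 200) * (1 + 1 / 25) * Real.exp (2 * (3 / 100)) : ℝ) ^ 2
      = ((1 + 1 / 200) * (1 + 1 / 25)) ^ 2 * Real.exp (3 / 25) := by rw [mul_pow, h1]
  rw [h3]
  norm_num at h2 ⊢
  nlinarith [h2, Real.exp_pos (3 / 25 : ℝ)]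
/-- ★ F1 ASSEMBLY (real proof): GLUE-G3A + GLUE-2A `F1OfModulusLawA` (v2, axis-centred) + the five laws at the constants of record ⇒ `FarEnergyLawCQ (4/5)`. -/
theorem farEnergyLawCQ_of_laws (hG : ModulusOfLawsG3A) (hF : F1OfModulusLawA) (hL : LandingExitLawAbove (5 / 4) 2)
    (hC : ThresholdCapLawCharged (1 / 200)) (hB : ThresholdCapLawBelow (1 / 200)) (hU : UnchargedCreepLaw (3 / 100))
    (hE : FarChainEntryExitLaw (1 / 25)) : FarEnergyLawCQ (4 / 5) := by
  have hsq := lam_sq_le_record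
  have hlam : (0 : ℝ) < (1 + 1 / 200) * (1 + 1 / 25) * Real.exp (2 * (3 / 100)) := by positivity
  exact hF _ hlam hsq (hG _ _ _ (by norm_num) (by norm_num) (by norm_num) hsq hL hC hB hU hE)
/-! ## §4 TOP LAYER — the whole `RateLawsHalfQ` by name, and the CANONICAL budgets -/
/-- ★★ SOCKET FORM (budget-parametric): the four laws by their TREE names ⇒ `RhW08.RateSplit.RateLawsHalfQ`. -/
theorem rateLawsHalfQ_of (aR aC : Budget) (hF1 : FarEnergyLawCQ (4 / 5)) (hF2 : EnergyRiseLawQ aR) (hC : ConsLawQ aC)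
    (hA : ApproachAllowanceQ (approachBudgetHalfQ aR aC)) : RhW08.RateSplit.RateLawsHalfQ :=
  ⟨aR, aC, hF1, hF2, hC, hA⟩
/-- the NON-FAR half of the socket (F2 ∧ C ∧ A with shared budgets). -/
def NonFarSocketsHalfQ : Prop :=
  ∃ aR aC : Budget, EnergyRiseLawQ aR ∧ ConsLawQ aC ∧ ApproachAllowanceQ (approachBudgetHalfQ aR aC)
/-- (K) conjunct split of the target: `RateLawsHalfQ ↔ F1 ∧ NonFarSocketsHalfQ`. -/
theorem rateLawsHalfQ_iff : RhW08.RateSplit.RateLawsHalfQ ↔ FarEnergyLawCQ (4 / 5) ∧ NonFarSocketsHalfQ := by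
  constructor
  · rintro ⟨aR, aC, h1, h2, h3, h4⟩
    exact ⟨h1, aR, aC, h2, h3, h4⟩
  · rintro ⟨h1, aR, aC, h2, h3, h4⟩
    exact ⟨aR, aC, h1, h2, h3, h4⟩
/-- CANONICAL (least) rise budget: the frame-wise supremum of the accumulated energy rises `energyRiseSumQ (k+1)` over the charged levels `k`
(`sSup ∅ = 0`; junk if unbounded, in which case NO budget satisfies F2 on that frame). -/
noncomputable def riseSupQ : Budget := fun η f x₀ s hmax R Hs B =>
  sSup ((fun k : ℕ => energyRiseSumQ η f x₀ s hmax R Hs B (k + 1)) ''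
    {k : ℕ | Charged (PTrkSQ PBot) StTrkDQ ReadyR2 η f x₀ s hmax R Hs B k})
/-- CANONICAL (least) consumption budget: the frame-wise supremum over the charged levels `k` of the consumption class's net cost minus the credits drawn,
`netCostQ (Cons∖Far) (k+1) − creditsQ (k+1)`. -/
noncomputable def consSupQ : Budget := fun η f x₀ s hmax R Hs B =>
  sSup ((fun k : ℕ => netCostQ (diffClass ConsLevelQ FarLevelQ) η f x₀ s hmax R Hs B (k + 1) - creditsQ η f x₀ s hmax R Hs B (k + 1)) ''
    {k : ℕ | Charged (PTrkSQ PBot) StTrkDQ ReadyR2 η f x₀ s hmax R Hs B k})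
/-- the non-far triple AT THE CANONICAL BUDGETS: F2c ∧ Cc ∧ Ac.  Ac is the ONE inequality carrying the analytic content of the non-far half:
per legal frame and charged `k`, `netCost_A(k+1) ≤ S₀ − (5/4)·energyPurseQ − (5/4)·riseSupQ − consSupQ + (B+1)/2`. -/
def CanonicalNonFarQ : Prop :=
  EnergyRiseLawQ riseSupQ ∧ ConsLawQ consSupQ ∧ ApproachAllowanceQ (approachBudgetHalfQ riseSupQ consSupQ)
/-- (K) F2 is UPWARD-closed in its budget. -/
theorem energyRiseLawQ_mono {aR aR' : Budget}
    (hle : ∀ (η : ℝ) (f : ℂ → ℂ) (x₀ s hmax R Hs : ℝ) (B : ℕ), aR η f x₀ s hmax R Hs B ≤ aR' η f x₀ s hmax R Hs B)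
    (h : EnergyRiseLawQ aR) : EnergyRiseLawQ aR' :=
  fun η f x₀ s hmax R Hs B hE k hk => (h η f x₀ s hmax R Hs B hE k hk).trans (hle η f x₀ s hmax R Hs B)
/-- (K) C is UPWARD-closed in its budget. -/
theorem consLawQ_mono {aC aC' : Budget}
    (hle : ∀ (η : ℝ) (f : ℂ → ℂ) (x₀ s hmax R Hs : ℝ) (B : ℕ), aC η f x₀ s hmax R Hs B ≤ aC' η f x₀ s hmax R Hs B)
    (h : ConsLawQ aC) : ConsLawQ aC' := by
  intro η f x₀ s hmax R Hs B hE k hk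
  have h1 := h η f x₀ s hmax R Hs B hE k hk
  have h2 := hle η f x₀ s hmax R Hs B
  linarith
/-- (K) A is DOWNWARD-closed in the two budgets entering its allowance `approachBudgetHalfQ aR aC = S₀ − (5/4)E − (5/4)aR − aC + (B+1)/2`. -/
theorem approachAllowanceQ_anti {aR aR' aC aC' : Budget}
    (hR : ∀ (η : ℝ) (f : ℂ → ℂ) (x₀ s hmax R Hs : ℝ) (B : ℕ), aR' η f x₀ s hmax R Hs B ≤ aR η f x₀ s hmax R Hs B)
    (hC : ∀ (η : ℝ) (f : ℂ → ℂ) (x₀ s hmax R Hs : ℝ) (B : ℕ), aC' η f x₀ s hmax R Hs B ≤ aC η f x₀ s hmax R Hs B)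
    (h : ApproachAllowanceQ (approachBudgetHalfQ aR aC)) : ApproachAllowanceQ (approachBudgetHalfQ aR' aC') := by
  intro η f x₀ s hmax R Hs B hE k hk
  have h1 := h η f x₀ s hmax R Hs B hE k hk
  have h2 := hR η f x₀ s hmax R Hs B
  have h3 := hC η f x₀ s hmax R Hs B
  rw [approachBudgetHalf_apply] at h1 ⊢
  linarith
/-- (K) under ANY rise budget, every charged level's accumulated rise is below the canonical budget (`le_csSup`). -/
theorem le_riseSupQ {aR : Budget} (h : EnergyRiseLawQ aR) {η : ℝ} {f : ℂ → ℂ} {x₀ s hmax R Hs : ℝ} {B : ℕ}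
    (hE : EngineHyps5 2 η f x₀ s hmax R Hs B) {k : ℕ} (hk : Charged (PTrkSQ PBot) StTrkDQ ReadyR2 η f x₀ s hmax R Hs B k) :
    energyRiseSumQ η f x₀ s hmax R Hs B (k + 1) ≤ riseSupQ η f x₀ s hmax R Hs B := by
  refine le_csSup ⟨aR η f x₀ s hmax R Hs B, ?_⟩ ⟨k, hk, rfl⟩
  rintro _ ⟨k', hk', rfl⟩
  exact h η f x₀ s hmax R Hs B hE k' hk'
/-- (K) the canonical rise budget is the LEAST one: below any rise budget on a frame with a charged level (`csSup_le`). -/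
theorem riseSupQ_le {aR : Budget} (h : EnergyRiseLawQ aR) {η : ℝ} {f : ℂ → ℂ} {x₀ s hmax R Hs : ℝ} {B : ℕ}
    (hE : EngineHyps5 2 η f x₀ s hmax R Hs B) {k : ℕ} (hk : Charged (PTrkSQ PBot) StTrkDQ ReadyR2 η f x₀ s hmax R Hs B k) :
    riseSupQ η f x₀ s hmax R Hs B ≤ aR η f x₀ s hmax R Hs B := by
  refine csSup_le ⟨_, k, hk, rfl⟩ ?_
  rintro _ ⟨k', hk', rfl⟩
  exact h η f x₀ s hmax R Hs B hE k' hk'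
/-- (K) under ANY consumption budget, every charged level's overdraft is below the canonical budget. -/
theorem le_consSupQ {aC : Budget} (h : ConsLawQ aC) {η : ℝ} {f : ℂ → ℂ} {x₀ s hmax R Hs : ℝ} {B : ℕ}
    (hE : EngineHyps5 2 η f x₀ s hmax R Hs B) {k : ℕ} (hk : Charged (PTrkSQ PBot) StTrkDQ ReadyR2 η f x₀ s hmax R Hs B k) :
    netCostQ (diffClass ConsLevelQ FarLevelQ) η f x₀ s hmax R Hs B (k + 1) - creditsQ η f x₀ s hmax R Hs B (k + 1) ≤
      consSupQ η f x₀ s hmax R Hs B := by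
  refine le_csSup ⟨aC η f x₀ s hmax R Hs B, ?_⟩ ⟨k, hk, rfl⟩
  rintro _ ⟨k', hk', rfl⟩
  have h1 := h η f x₀ s hmax R Hs B hE k' hk'
  simp only
  linarith
/-- (K) the canonical consumption budget is the LEAST one. -/
theorem consSupQ_le {aC : Budget} (h : ConsLawQ aC) {η : ℝ} {f : ℂ → ℂ} {x₀ s hmax R Hs : ℝ} {B : ℕ}
    (hE : EngineHyps5 2 η f x₀ s hmax R Hs B) {k : ℕ} (hk : Charged (PTrkSQ PBot) StTrkDQ ReadyR2 η f x₀ s hmax R Hs B k) :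
    consSupQ η f x₀ s hmax R Hs B ≤ aC η f x₀ s hmax R Hs B := by
  refine csSup_le ⟨_, k, hk, rfl⟩ ?_
  rintro _ ⟨k', hk', rfl⟩
  have h1 := h η f x₀ s hmax R Hs B hE k' hk'
  simp only
  linarith
/-- (K) F2 at any budget ⇒ F2 at the canonical budget («the rises are bounded on every legal frame»). -/
theorem energyRiseLawQ_canonical {aR : Budget} (h : EnergyRiseLawQ aR) : EnergyRiseLawQ riseSupQ :=
  fun _ _ _ _ _ _ _ _ hE _ hk => le_riseSupQ h hE hk
/-- (K) C at any budget ⇒ C at the canonical budget («the overdraft is bounded on every legal frame»). -/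
theorem consLawQ_canonical {aC : Budget} (h : ConsLawQ aC) : ConsLawQ consSupQ := by
  intro η f x₀ s hmax R Hs B hE k hk
  have h1 := le_consSupQ h hE hk
  linarith
/-- (K) A at the allowance of any admissible budgets ⇒ A at the canonical allowance (the canonical budgets are the least ones, A is antitone). -/
theorem approachAllowanceQ_canonical {aR aC : Budget} (hR : EnergyRiseLawQ aR) (hC : ConsLawQ aC)
    (hA : ApproachAllowanceQ (approachBudgetHalfQ aR aC)) : ApproachAllowanceQ (approachBudgetHalfQ riseSupQ consSupQ) := by
  intro η f x₀ s hmax R Hs B hE k hk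
  have h1 := hA η f x₀ s hmax R Hs B hE k hk
  have h2 := riseSupQ_le hR hE hk
  have h3 := consSupQ_le hC hE hk
  rw [approachBudgetHalf_apply] at h1 ⊢
  linarith
/-- ★ (K) **CANONICAL BUDGETS LOSE NOTHING**: the non-far half holds iff it holds at the canonical budgets. -/
theorem nonFarSocketsHalfQ_iff_canonical : NonFarSocketsHalfQ ↔ CanonicalNonFarQ := by
  constructor
  · rintro ⟨aR, aC, hR, hC, hA⟩
    exact ⟨energyRiseLawQ_canonical hR, consLawQ_canonical hC, approachAllowanceQ_canonical hR hC hA⟩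
  · rintro ⟨hR, hC, hA⟩
    exact ⟨riseSupQ, consSupQ, hR, hC, hA⟩
/-- ★★ (K) the target at the canonical budgets: `RateLawsHalfQ ↔ F1 ∧ F2c ∧ Cc ∧ Ac`. -/
theorem rateLawsHalfQ_iff_canonical :
    RhW08.RateSplit.RateLawsHalfQ ↔ FarEnergyLawCQ (4 / 5) ∧ EnergyRiseLawQ riseSupQ ∧ ConsLawQ consSupQ ∧
      ApproachAllowanceQ (approachBudgetHalfQ riseSupQ consSupQ) := by
  rw [rateLawsHalfQ_iff, nonFarSocketsHalfQ_iff_canonical]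
  rfl
/-- ★★ (K) ASSEMBLY at the canonical budgets: F1 + F2c + Cc + Ac ⇒ `RateLawsHalfQ` by name. -/
theorem rateLawsHalfQ_of_canonical (hF1 : FarEnergyLawCQ (4 / 5)) (hF2 : EnergyRiseLawQ riseSupQ) (hC : ConsLawQ consSupQ)
    (hA : ApproachAllowanceQ (approachBudgetHalfQ riseSupQ consSupQ)) : RhW08.RateSplit.RateLawsHalfQ :=
  rateLawsHalfQ_of riseSupQ consSupQ hF1 hF2 hC hA
/-- ★★★ (K) FULL ASSEMBLY of the lens-2 line: the seven F1 hypotheses (glue G3, GLUE-2, landing exit, two caps, creep, entry/exit at the constants of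
record) + the canonical non-far triple ⇒ `RateLawsHalfQ` by name. -/
theorem rateLawsHalfQ_of_laws (hG : ModulusOfLawsG3A) (hF : F1OfModulusLawA) (hL : LandingExitLawAbove (5 / 4) 2)
    (hCap : ThresholdCapLawCharged (1 / 200)) (hB : ThresholdCapLawBelow (1 / 200)) (hU : UnchargedCreepLaw (3 / 100))
    (hE : FarChainEntryExitLaw (1 / 25)) (hN : CanonicalNonFarQ) : RhW08.RateSplit.RateLawsHalfQ :=
  rateLawsHalfQ_of_canonical (farEnergyLawCQ_of_laws hG hF hL hCap hB hU hE) hN.1 hN.2.1 hN.2.2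
/-- (K) and on to the registered RATE^B door `RestRateBotPQ halfPurse` (tree `restRateBotPQ_half_of_rateLaws`). -/
theorem restRateBotPQ_half_of_canonical (hF1 : FarEnergyLawCQ (4 / 5)) (hN : CanonicalNonFarQ) : RestRateBotPQ halfPurse :=
  restRateBotPQ_half_of_rateLaws (rateLawsHalfQ_of_canonical hF1 hN.1 hN.2.1 hN.2.2)

end RhW08.BurgersRateG3
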